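import Literature.MathematicalPhysics.QuantumFieldTheory.Balaban1983to89.B5G183Strip

/-!
# `Balaban1983to89.B5G183Zero` — the VALUE of the continued (1.83) fiber matrix at `p′ = 0` is Bałaban's zero fiber `diag(a⁻¹ at l = 0, Δ(l)⁻¹ else)` (`a = 1`): the printed sentence «the values at p′ = 0 agree with the second and third equalities in (1.83)», kernel-certified

T. Bałaban, *Propagators and renormalization transformations for lattice gauge theories. I*, Commun. Math.
Phys. **95**, 17–40 (1984) [`Balaban1984PropagatorsI`, cell paper B5].  What the paper PRINTS (verbatim; renders
`1984-cmp95-propagators-rt-I-p015-x2.png`, `-p016-x2.png`, `-p017-x2.png` read as images by this lineage; the full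
transcription of (1.83)–(1.84) is the header of `B5Prop11Bound` / `B5G183Strip`):
* p. 31 [PDF 15], (1.83), after the long `p′ ≠ 0` formula: «for p′ ≠ 0,  Ã_μ(l) = 1/Δ(l) · J̃_μ(l),  Ã_μ(0) = a⁻¹ J̃_μ(0),»
  (the SECOND and THIRD equalities of (1.83): the fiber `p′ = 0`, where `l` runs over `Λ̃ = 2π·{0,…,n−1}^d` and
  `Δ(l) = Σ_μ S_ξ(l_μ)` is the fine-lattice Laplacian symbol at the alias point `l`);
* p. 32 [PDF 16]: «Owing to the cancellation of the terms with l′ = l, the above expression can be extended by continuity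
  to p′ = 0.» … «Again taking into account the cancellation of the terms with l″ = l the above expression is well defined
  by continuity for p′ = 0, and we even get an additional factor Δ₀(p′). …»;
* p. 33 [PDF 17], ll. 1–2 (the sentence certified HERE): «It can be easily calculated that the values at p′ = 0 agree
  with the second and third equalities in (1.83).»

CITATION HEADER (lean-in-tree rule).  This module is a SUPPLEMENT, not a quotation: the paper asserts the agreement of
the `p′ → 0` limit of the `p′ ≠ 0` formula with the `p′ = 0` fiber without calculation; below the calculation is done
by the kernel for the tree's continued entry symbol `B5G183Strip.g183` (whose restriction to real `p′ ≠ 0` IS the typed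
fiber matrix `B5Prop11Bound.Fiber.G` of (1.83) on `B5Prop11Fiber.balabanFiber`, `B5G183Strip.g183_ofReal`) and for the
tree's zero fiber `B5Prop11Bound.G₀`.  Everything is `[folklore]` audit mathematics; `[cite: …]` tags mark the
location of printed TEXT only.  ABSOLUTE RULE honoured: no statement of the papers is used as a hypothesis; the only
import is the kernel-proved tree module `B5G183Strip`.  `a = 1` throughout (Prop. 1.1 «if we put a = 1»; the
convention of `B5G183Strip`, `B5Hk163Strip`, `B5Symbol166`), so the printed `a⁻¹` at `l = 0` is `1`; `U = 1`.

CONTENT.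
§1 the leaves of the regrouped normal form at the complex origin `p′ = 0` (closed forms, all `n ≥ 1`, all `d`):
   `S₁(0) = S_ξ(0) = Δ(0) = 0`; `|u(l)|²(0) = δ_{l0}` (`U_at0`); `c_λ(0) = 1`, `R̃_λ(0) = 0`, `Y_λ(0) = 1`,
   `R^G_λ(0) = Y^G_λ(0) = 1`, `F^G(0) = 1`, `Π_λY^G_λ(0)/F^G(0) = 1` (`midG_at0`), `X_{≠0}(0) = 0`, `𝒩(0) = 1`,
   `∂_{1,μ}(0) = conj ∂_{1,μ}(0) = 0`, `v_μ(l)(0) = conj v_μ(l)(0) = δ_{l_μ 0}` (a full period of `n`-th roots of unity),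
   `u(l)(0) = ū(l)(0) = δ_{l0}`, `∂_μ(0+0) = 0`;
§2 hence BOTH square brackets of (1.83) (divided by `Δ(p′)`, `B5G183Strip.B1/B2`) VANISH at `p′ = 0` for every alias
   index (`B1_at0`, `B2_at0`: at `l = 0` through `∂_μ(0) = ∂_{1,μ}(0) = 0`, at `l ≠ 0` through `ū(l)(0) = 0`), the
   diagonal block is `A(l,l′;μ)(0) = δ_{ll′}·(1 at l = 0, 1/Δ(l) else)` (`diagG_at0`: the `l = l′ = 0` entry is the
   `l′ = l`-cancelled value `R^G_μ(0)/Y^G_μ(0) = 1`, every correction term carries `ū(l)(0)u(l′)(0) = 0` off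
   `l = l′ = 0`), and the full entry is `g183 μ ν l l′ (0) = δ_{μν}δ_{ll′}·(1 at l = 0, 1/Δ(l) else)` (`g183_at0`);
§3 `Δ(l) = DeltaXi n 0 (shift n l 0)` is the real number `DeltaXir n 0 (shiftr n l 0) ≥ 4` for `l ≠ 0`, and the value
   matrix IS pv15's zero fiber: `g183 n μ ν l l′ 0 = G₀ 0 1 Δ (l,μ) (l′,ν)` (`G₀_at0_apply`, `g183_at0_eq_G₀`);
   pv15's weighted bound instantiates to `‖w₁ G₀ w₂*‖ ≤ 1` (`opNorm_sandwich_G₀_at0_le`);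
§4 CONTINUITY: the origin lies in the zero-free strip of `B5G183Strip` (§5 there), so `g183` is holomorphic, hence
   continuous, at `p′ = 0` (`continuousAt_g183_zero`), and the printed sentence follows in `ε–δ` form for the TYPED
   (1.83) matrix: the entries of `Fiber.G` on `balabanFiber n _ 1 _ s _ _` converge to those of the zero fiber as
   `s → 0` through the punctured Brillouin zone (`fiberG_tendsto_G₀`, `fiberG_tendsto_values`) — the values at `p′ = 0` of the
   continuity extension of the `p′ ≠ 0` formula AGREE with the second and third equalities of (1.83), at `a = 1`.

HONEST SCOPE.  (i) `a = 1` only: the printed `a⁻¹` at `l = 0` for general `a > 0` is NOT treated (the tree's continued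
symbol `g183` is the `a = 1` symbol; `G₀ o a Δ` keeps `a` general but is instantiated at `a = 1` here).  (ii) This is an
identity of SYMBOLS / matrix entries; the operator statements (1.82) «GJ = GJ′ + a⁻¹J₀» and `G = Δ_a⁻¹` are pv15's
`B5Prop11Inverse` business and are not re-certified here.  (iii) No kernel, no decay, no bound beyond the instantiated
zero-fiber bound of §3: the random-walk / kernel side of Proposition 1.1 is `B5G183CovDecay`/`B5G183FreeDecay` (pv15) and
open residuals recorded in the cell's GAPS ledger.  (iv) Junk values: none of the `if`-filled removable points of the
leaves is hit by a FALSE branch here — at `p′ = 0` the filled values (`uFactor n 0 0 = 1`, `vSym = 1` where `∂_μ = 0`)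
are the printed continuous extensions ((1.61): `v_μ → 1`), and §4 certifies continuity independently of any filling.
-/

noncomputable section

open scoped BigOperators ComplexConjugate Topology Matrix.Norms.L2Operator
open Finset Complex Filter

namespace Literature.MathematicalPhysics.QuantumFieldTheory.Balaban1983to89.B5G183Zero

open Literature.MathematicalPhysics.QuantumFieldTheory.Balaban1983to89.B4Strip
open Literature.MathematicalPhysics.QuantumFieldTheory.Balaban1983to89.B4ContourShift
open Literature.MathematicalPhysics.QuantumFieldTheory.Balaban1983to89.B5Prop11Leaves
open Literature.MathematicalPhysics.QuantumFieldTheory.Balaban1983to89.B5Prop11Fiber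
open Literature.MathematicalPhysics.QuantumFieldTheory.Balaban1983to89.B5Prop11Bound
open Literature.MathematicalPhysics.QuantumFieldTheory.Balaban1983to89.B5Symbol166
open Literature.MathematicalPhysics.QuantumFieldTheory.Balaban1983to89.B5Strip145
open Literature.MathematicalPhysics.QuantumFieldTheory.Balaban1983to89.B5Symbol166Strip
open Literature.MathematicalPhysics.QuantumFieldTheory.Balaban1983to89.B5Hk163Strip
open Literature.MathematicalPhysics.QuantumFieldTheory.Balaban1983to89.B5G183Strip

variable {d : ℕ}

/-! ## §1. The leaves of the regrouped (1.83) normal form at the complex origin `p′ = 0` -/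

/-- the real origin embeds to the complex origin. [folklore] -/
theorem ofRealVec_zero_eq : ofRealVec (0 : Fin d → ℝ) = (0 : Fin d → ℂ) := by
  funext μ; simp [ofRealVec]

/-- every coordinate of the real origin lies in `[−π, π]`. [folklore] -/
theorem abs_zero_le_pi (μ : Fin d) : |(0 : Fin d → ℝ) μ| ≤ Real.pi := by
  rw [Pi.zero_apply, abs_zero]; exact Real.pi_pos.le

/-- `S₁(0) = 2 − 2cos 0 = 0`. [folklore] -/
theorem S1_at0 : S1 0 = 0 := by simp [S1]

/-- `S_ξ(0) = 0`. [folklore] -/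
theorem Sxi_at0 (n : ℕ) : Sxi n 0 = 0 := by simp [Sxi]

/-- `Δ(p′) = Σ_μ S_ξ(p′_μ)` VANISHES at `p′ = 0` — the zero of the massless fine-lattice symbol that every printed factor
`1/Δ(p′)`, `φ_μ⁻¹`, … of (1.83) carries and that the regrouped normal form has cancelled. [folklore] -/
theorem DeltaXi_at0 (n : ℕ) : DeltaXi n 0 (0 : Fin d → ℂ) = 0 := by
  simp [DeltaXi, Sxi]

/-- one factor of `|u(l)|²` at `p′ = 0`: the filled value `1` for `l_μ = 0`, and `S₁(0)/S_ξ(l_μ) = 0` for `l_μ ≠ 0`. [folklore] -/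
theorem uFactor_at0 (n j : ℕ) : uFactor n j 0 = if j = 0 then 1 else 0 := by
  by_cases hj : j = 0
  · subst hj; simp [uFactor]
  · rw [if_neg hj]; simp [uFactor, hj, S1_at0]

/-- `|u(l)|²(p′ = 0) = δ_{l,0}` ((2.45)/(1.31): for `l ≠ 0` some factor is `S₁(0)/S_ξ(l_μ) = 0`). [folklore] -/
theorem U_at0 (n : ℕ) [NeZero n] (k : Fin d → Fin n) :
    U n k (0 : Fin d → ℂ) = if k = fun _ => 0 then 1 else 0 := by
  by_cases hk : k = fun _ => 0
  · subst hk; simp [U, uFactor_at0]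
  · rw [if_neg hk]
    obtain ⟨μ, hμ⟩ := Function.ne_iff.mp hk
    have hμ' : (k μ : ℕ) ≠ 0 := fun h => hμ (Fin.ext (by rw [h, Fin.val_zero]))
    refine Finset.prod_eq_zero (Finset.mem_univ μ) ?_
    rw [Pi.zero_apply, uFactor_at0, if_neg hμ']

/-- `c_λ(0) = |u(0)|²(0)·uFactor(0,0) = 1`. [folklore] -/
theorem cfac_at0 (n : ℕ) [NeZero n] (lam : Fin d) : cfac n lam (0 : Fin d → ℂ) = 1 := by
  unfold cfac
  rw [U_at0, if_pos rfl, Pi.zero_apply, uFactor_at0, if_pos rfl, one_mul]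

/-- `R̃_λ(0) = 0` (every `l ≠ 0` term carries `|u(l)|²(0) = 0`). [folklore] -/
theorem Rt_at0 (n : ℕ) [NeZero n] (lam : Fin d) : Rt n lam (0 : Fin d → ℂ) = 0 := by
  unfold Rt
  refine Finset.sum_eq_zero fun k hk => ?_
  rw [U_at0, if_neg (Finset.ne_of_mem_erase hk), zero_mul, zero_div]

/-- `Y_λ(0) = c_λ(0) + Δ(0)·R̃_λ(0) = 1`. [folklore] -/
theorem Yc_at0 (n : ℕ) [NeZero n] (lam : Fin d) : Yc n lam (0 : Fin d → ℂ) = 1 := by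
  unfold Yc
  rw [cfac_at0, Rt_at0, mul_zero, add_zero]

/-- `R^G_λ(0) = 1 + R̃_λ(0) = 1`. [folklore] -/
theorem RG_at0 (n : ℕ) [NeZero n] (lam : Fin d) : RG n lam (0 : Fin d → ℂ) = 1 := by
  unfold RG
  rw [Rt_at0, add_zero]

/-- `Y^G_λ(0) = Δ(0) + Y_λ(0) = 1` (consistent with the printed limit (1.85) `Δ₀(p′)φ_μ(p′) → a = 1`, since
`Y^G_λ = Δ·φ_λ` on the torus and `Δ/Δ₀ → 1`). [folklore] -/
theorem YG_at0 (n : ℕ) [NeZero n] (lam : Fin d) : YG n lam (0 : Fin d → ℂ) = 1 := by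
  unfold YG
  rw [DeltaXi_at0, Yc_at0, zero_add]

/-- `F^G(0) = |u(0)|²(0)^d + Σ_λ S₁(0)·(…) = 1`. [folklore] -/
theorem FG_at0 (n : ℕ) [NeZero n] : FG n (0 : Fin d → ℂ) = 1 := by
  unfold FG
  rw [U_at0, if_pos rfl, one_pow]
  simp only [Pi.zero_apply, S1_at0, zero_mul, Finset.sum_const_zero, add_zero]

/-- the scalar between the square brackets at `p′ = 0`: `Π_λ Y^G_λ(0)/F^G(0) = 1` (the printed «inverse of the
expression (1.86)» times the two extracted factors `Δ₀(p′)`, at the origin). [folklore] -/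
theorem midG_at0 (n : ℕ) [NeZero n] : midG n (0 : Fin d → ℂ) = 1 := by
  unfold midG
  simp [YG_at0, FG_at0]

/-- `X_{≠0}(0) = Σ_{l≠0} |u(l)|²(0)/Δ²(l) = 0`. [folklore] -/
theorem Xne_at0 (n : ℕ) [NeZero n] : Xne n (0 : Fin d → ℂ) = 0 := by
  unfold Xne
  refine Finset.sum_eq_zero fun k hk => ?_
  rw [U_at0, if_neg (Finset.ne_of_mem_erase hk), zero_div]

/-- `𝒩(0) = |u(0)|²(0) + Δ(0)²·X_{≠0}(0) = 1`. [folklore] -/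
theorem Ncal_at0 (n : ℕ) [NeZero n] : Ncal n (0 : Fin d → ℂ) = 1 := by
  unfold Ncal
  rw [U_at0, if_pos rfl, Xne_at0, mul_zero, add_zero]

/-- `∂_{1,μ}(0) = e^{0} − 1 = 0`. [folklore] -/
theorem expFacPos_at0 (μ : Fin d) : expFacPos μ (0 : Fin d → ℂ) = 0 := by
  simp [expFacPos]

/-- `conj ∂_{1,μ}(0) = e^{−0} − 1 = 0`. [folklore] -/
theorem expFacNeg_at0 (μ : Fin d) : expFacNeg μ (0 : Fin d → ℂ) = 0 := by
  simp [expFacNeg]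

/-- `v_μ(l)` at `p′ = 0`: `(1/n)Σ_{j<n} e^{2πi l_μ j/(2πn)} = δ_{l_μ,0}` (a full period of an `n`-th root of unity sums to
zero; obtained from the real form `vC_ofReal`/`vSym` and `dSym_eq_zero_iff`, i.e. `v_μ(l)(0) = ∂_{1,μ}(0)/∂_μ(l) = 0` for
`l_μ ≠ 0` and the filled value `1` of (1.61) at `l_μ = 0`). [folklore] -/
theorem vC_at0 (n : ℕ) [NeZero n] (k : Fin d → Fin n) (μ : Fin d) :
    vC n k (0 : Fin d → ℂ) μ = if k μ = 0 then 1 else 0 := by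
  have hn : 1 ≤ n := Nat.one_le_iff_ne_zero.mpr (NeZero.ne n)
  have h := vC_ofReal n k (0 : Fin d → ℝ) μ
  rw [ofRealVec_zero_eq] at h
  rw [h, vSym]
  have hiff : dSym n k (0 : Fin d → ℝ) μ = 0 ↔ k μ = 0 := by
    rw [dSym_eq_zero_iff n hn k 0 μ (abs_zero_le_pi μ)]
    simp
  have h1 : d1Sym (0 : Fin d → ℝ) μ = 0 := by simp [d1Sym]
  by_cases hk : k μ = 0
  · rw [if_pos (hiff.mpr hk), if_pos hk]
  · rw [if_neg (fun h' => hk (hiff.mp h')), if_neg hk, h1, zero_div]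

/-- `conj v_μ(l)` at `p′ = 0` is the same `δ_{l_μ,0}`. [folklore] -/
theorem vCbar_at0 (n : ℕ) [NeZero n] (k : Fin d → Fin n) (μ : Fin d) :
    vCbar n k (0 : Fin d → ℂ) μ = if k μ = 0 then 1 else 0 := by
  have h := vCbar_ofReal n k (0 : Fin d → ℝ) μ
  have h' := vC_ofReal n k (0 : Fin d → ℝ) μ
  rw [ofRealVec_zero_eq] at h h'
  rw [h, ← h', vC_at0]
  split_ifs <;> simp

/-- `u(l)(0) = Π_μ v_μ(l)(0) = δ_{l,0}`. [folklore] -/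
theorem uC_at0 (n : ℕ) [NeZero n] (k : Fin d → Fin n) :
    uC n k (0 : Fin d → ℂ) = if k = fun _ => 0 then 1 else 0 := by
  unfold uC
  by_cases hk : k = fun _ => 0
  · subst hk; simp [vC_at0]
  · rw [if_neg hk]
    obtain ⟨μ, hμ⟩ := Function.ne_iff.mp hk
    have hμ' : ¬ k μ = 0 := hμ
    exact Finset.prod_eq_zero (Finset.mem_univ μ) (by rw [vC_at0, if_neg hμ'])

/-- `ū(l)(0) = Π_μ conj v_μ(l)(0) = δ_{l,0}`. [folklore] -/
theorem uCbar_at0 (n : ℕ) [NeZero n] (k : Fin d → Fin n) :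
    uCbar n k (0 : Fin d → ℂ) = if k = fun _ => 0 then 1 else 0 := by
  unfold uCbar
  by_cases hk : k = fun _ => 0
  · subst hk; simp [vCbar_at0]
  · rw [if_neg hk]
    obtain ⟨μ, hμ⟩ := Function.ne_iff.mp hk
    have hμ' : ¬ k μ = 0 := hμ
    exact Finset.prod_eq_zero (Finset.mem_univ μ) (by rw [vCbar_at0, if_neg hμ'])

/-- `∂_μ(p′ + l)` at `p′ = 0`, `l = 0` vanishes: `n(e^{0} − 1) = 0`. [folklore] -/
theorem dC_origin_at0 (n : ℕ) [NeZero n] (μ : Fin d) :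
    dC n (fun _ => (0 : Fin n)) (0 : Fin d → ℂ) μ = 0 := by
  unfold dC
  rw [shift_zero]
  simp

/-- `conj ∂_μ(p′ + l)` at `p′ = 0`, `l = 0` vanishes. [folklore] -/
theorem dCbar_origin_at0 (n : ℕ) [NeZero n] (μ : Fin d) :
    dCbar n (fun _ => (0 : Fin n)) (0 : Fin d → ℂ) μ = 0 := by
  unfold dCbar
  rw [shift_zero]
  simp

/-! ## §2. The brackets vanish and the diagonal block is `δ_{ll′}·(1, 1/Δ(l))` at `p′ = 0` -/

/-- the FIRST square bracket of (1.83) (divided by `Δ(p′)`) VANISHES at `p′ = 0` for every alias index `l`: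
at `l = 0` through `∂_μ(0) = 0` and `∂_{1,μ}(0) = 0`, at `l ≠ 0` through the prefactor `ū(l)(0) = 0`. [folklore] -/
theorem B1_at0 (n : ℕ) [NeZero n] (μ : Fin d) (k : Fin d → Fin n) : B1 n μ k (0 : Fin d → ℂ) = 0 := by
  unfold B1
  by_cases hk : k = fun _ => 0
  · rw [if_pos hk]
    subst hk
    rw [dC_origin_at0, expFacPos_at0]
    simp
  · rw [if_neg hk, uCbar_at0, if_neg hk, zero_mul]

/-- the SECOND square bracket of (1.83) (divided by `Δ(p′)`) VANISHES at `p′ = 0` for every alias index `l′`. [folklore] -/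
theorem B2_at0 (n : ℕ) [NeZero n] (ν : Fin d) (k' : Fin d → Fin n) : B2 n ν k' (0 : Fin d → ℂ) = 0 := by
  unfold B2
  by_cases hk : k' = fun _ => 0
  · rw [if_pos hk]
    subst hk
    rw [dCbar_origin_at0, expFacNeg_at0]
    simp
  · rw [if_neg hk, uC_at0, if_neg hk, zero_mul]

/-- the diagonal block at `p′ = 0`: `A(l,l′;μ)(0) = δ_{ll′}·(1 at l = 0, 1/Δ(l) else)` — at `l = l′ = 0` the
`l′ = l`-cancelled entry `R^G_μ(0)/Y^G_μ(0) = 1`; elsewhere the correction term carries `ū(l)(0)·u(l′)(0) = 0`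
(one of `l, l′` is `≠ 0`). [folklore] -/
theorem diagG_at0 (n : ℕ) [NeZero n] (μ : Fin d) (k k' : Fin d → Fin n) :
    diagG n μ k k' (0 : Fin d → ℂ)
      = if k = k' then (if k = fun _ => 0 then 1 else 1 / DeltaXi n 0 (shift n k 0)) else 0 := by
  unfold diagG
  by_cases h00 : k = (fun _ => 0) ∧ k' = (fun _ => 0)
  · obtain ⟨hk, hk'⟩ := h00
    subst hk; subst hk'
    rw [if_pos (And.intro rfl rfl), RG_at0, YG_at0, div_one, if_pos rfl, if_pos rfl]
  · rw [if_neg h00]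
    have hz : uCbar n k (0 : Fin d → ℂ) * vCbar n k 0 μ * (uC n k' 0 * vC n k' 0 μ) = 0 := by
      by_cases hk : k = fun _ => 0
      · have hk' : ¬ k' = fun _ => 0 := fun h => h00 ⟨hk, h⟩
        rw [uC_at0, if_neg hk']; ring
      · rw [uCbar_at0, if_neg hk]; ring
    rw [hz, zero_mul, zero_div, sub_zero]
    by_cases hkk : k = k'
    · subst hkk
      have hk : ¬ k = fun _ => 0 := fun h => h00 ⟨h, h⟩
      rw [if_pos rfl, if_pos rfl, if_neg hk]
    · rw [if_neg hkk, if_neg hkk]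

/-- **THE VALUE OF THE CONTINUED (1.83) ENTRY SYMBOL AT `p′ = 0`**: for every `n ≥ 1`, all `μ, ν` and all alias
indices `l, l′`,  `g183 μ ν l l′ (0) = δ_{μν}·δ_{ll′}·(1 at l = 0, 1/Δ(l) else)` — the third term of (1.83) drops out
(both brackets vanish), the second term drops out off `l = l′ = 0` and at `l = l′ = 0` combines with the first into
`R^G/Y^G = 1 = a⁻¹`. [folklore] -/
theorem g183_at0 (n : ℕ) [NeZero n] (μ ν : Fin d) (k k' : Fin d → Fin n) :
    g183 n μ ν k k' (0 : Fin d → ℂ)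
      = if k = k' ∧ μ = ν then (if k = fun _ => 0 then 1 else 1 / DeltaXi n 0 (shift n k 0)) else 0 := by
  unfold g183
  simp only [B1_at0, B2_at0, mul_zero, add_zero]
  rw [diagG_at0]
  by_cases hμν : μ = ν
  · subst hμν
    rw [if_pos rfl]
    by_cases hkk : k = k'
    · rw [if_pos hkk, if_pos (And.intro hkk rfl)]
    · rw [if_neg hkk, if_neg (fun h => hkk h.1)]
  · rw [if_neg hμν, if_neg (fun h => hμν h.2)]

/-! ## §3. `Δ(l)` is real `≥ 4` and the value matrix is pv15's zero fiber `G₀` -/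

/-- `Δ(l) = DeltaXi n 0 (shift n l 0)` is the real number `DeltaXir n 0 (shiftr n l 0)` (`= Σ_μ n²(2 − 2cos(2πl_μ/n))`). [folklore] -/
theorem DeltaXi_shift_at0 (n : ℕ) (k : Fin d → Fin n) :
    DeltaXi n 0 (shift n k (0 : Fin d → ℂ)) = ((DeltaXir n 0 (shiftr n k (0 : Fin d → ℝ)) : ℝ) : ℂ) := by
  rw [← ofRealVec_zero_eq, shift_ofReal, DeltaXi_ofReal]

/-- `Δ(l) ≥ 4` for `l ≠ 0` (`B5Prop11Leaves.DeltaXir_shift_ge_four` at `p′ = 0`). [folklore] -/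
theorem DeltaXir_shiftr_at0_ge_four (n : ℕ) [NeZero n] (k : Fin d → Fin n) (hk : k ≠ fun _ => 0) :
    4 ≤ DeltaXir n 0 (shiftr n k (0 : Fin d → ℝ)) :=
  DeltaXir_shift_ge_four n k hk 0 abs_zero_le_pi

/-- `Δ(l) > 0` for `l ≠ 0` (the hypothesis `hΔ` of pv15's zero-fiber bound). [folklore] -/
theorem DeltaXir_shiftr_at0_pos (n : ℕ) [NeZero n] (k : Fin d → Fin n) (hk : k ≠ fun _ => 0) :
    0 < DeltaXir n 0 (shiftr n k (0 : Fin d → ℝ)) :=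
  lt_of_lt_of_le (by norm_num) (DeltaXir_shiftr_at0_ge_four n k hk)

/-- the entries of Bałaban's zero fiber at `a = 1` — pv15's `G₀` (the second and third equalities of (1.83),
«Ã_μ(l) = Δ(l)⁻¹J̃_μ(l), Ã_μ(0) = a⁻¹J̃_μ(0)», as the diagonal matrix `diag(a⁻¹ at l = 0, Δ(l)⁻¹ else)`) instantiated
with the offset `l = 0 ↦ (fun _ => 0)`, `a = 1` and `Δ(l) = DeltaXir n 0 (shiftr n l 0)` (the instantiation is ours):
`δ_{μν}δ_{ll′}·(1 at l = 0, 1/Δ(l) else)`. [folklore] -/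
theorem G₀_at0_apply (n : ℕ) [NeZero n] (μ ν : Fin d) (k k' : Fin d → Fin n) :
    G₀ (fun _ => (0 : Fin n)) 1 (fun l => DeltaXir n 0 (shiftr n l (0 : Fin d → ℝ))) (k, μ) (k', ν)
      = if k = k' ∧ μ = ν then
          (if k = fun _ => 0 then 1 else 1 / ((DeltaXir n 0 (shiftr n k (0 : Fin d → ℝ)) : ℝ) : ℂ))
        else 0 := by
  unfold G₀
  rw [Matrix.diagonal_apply]
  by_cases h : k = k' ∧ μ = ν
  · obtain ⟨hk, hμ⟩ := h
    subst hk; subst hμ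
    rw [if_pos rfl, if_pos (And.intro rfl rfl)]
    dsimp only
    rw [Complex.ofReal_one, div_one]
  · have hne : (k, μ) ≠ (k', ν) := fun he => h ⟨congrArg Prod.fst he, congrArg Prod.snd he⟩
    rw [if_neg hne, if_neg h]

/-- **`g183(0) = G₀`**: the value of the continued (1.83) entry symbol at `p′ = 0` IS the `((l,μ),(l′,ν))` entry of
Bałaban's zero fiber `B5Prop11Bound.G₀` (offset `0`, `a = 1`, `Δ(l) = DeltaXir n 0 (shiftr n l 0)`), for every `n ≥ 1`,
`d`, `μ, ν, l, l′`. [cite: Balaban1984PropagatorsI, (1.83) p.31 (second and third equalities; text only, the calculation is ours)] -/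
theorem g183_at0_eq_G₀ (n : ℕ) [NeZero n] (μ ν : Fin d) (k k' : Fin d → Fin n) :
    g183 n μ ν k k' (0 : Fin d → ℂ) = G₀ (fun _ => (0 : Fin n)) 1 (fun l => DeltaXir n 0 (shiftr n l (0 : Fin d → ℝ))) (k, μ) (k', ν) := by
  rw [g183_at0, G₀_at0_apply, DeltaXi_shift_at0]

/-- pv15's weighted zero-fiber bound instantiated (`B5Prop11Bound.opNorm_sandwich_G₀_le` with `a = 1`, `Δ(l) > 0` for
`l ≠ 0`): for weights with `|w₁(0)w₂(0)| ≤ 1` and `|w₁(l)w₂(l)| ≤ Δ(l)` (`l ≠ 0`), `‖w₁·G₀·w₂*‖_{ℓ²→ℓ²} ≤ max(1/1, 1) = 1`. [folklore] -/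
theorem opNorm_sandwich_G₀_at0_le (n : ℕ) [NeZero n] (w₁ w₂ : (Fin d → Fin n) → ℂ)
    (hwo : ‖w₁ (fun _ => 0)‖ * ‖w₂ (fun _ => 0)‖ ≤ 1)
    (hwl : ∀ l, l ≠ (fun _ => 0) → ‖w₁ l‖ * ‖w₂ l‖ ≤ DeltaXir n 0 (shiftr n l (0 : Fin d → ℝ))) :
    ‖sandwich w₁ w₂ (G₀ (d := d) (fun _ => (0 : Fin n)) 1 (fun l => DeltaXir n 0 (shiftr n l (0 : Fin d → ℝ))))‖
      ≤ 1 := by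
  have h := opNorm_sandwich_G₀_le (d := d) (fun _ => (0 : Fin n)) one_pos
    (fun l => DeltaXir n 0 (shiftr n l (0 : Fin d → ℝ))) (fun l hl => DeltaXir_shiftr_at0_pos n l hl) w₁ w₂ hwo hwl
  have h1 : max (1 / (1 : ℝ)) 1 = 1 := by norm_num
  rw [h1] at h
  exact h

/-! ## §4. Continuity at `p′ = 0` and the printed sentence (p. 33, ll. 1–2) in `ε–δ` form -/

/-- the complex origin lies in every strip of nonnegative half-width. [folklore] -/
theorem zero_mem_Strip {κ : ℝ} (hκ : 0 ≤ κ) : (0 : Fin d → ℂ) ∈ Strip d κ := by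
  intro μ
  simp only [Pi.zero_apply, Complex.zero_re, Complex.zero_im, abs_zero]
  exact ⟨Real.pi_pos.le, hκ⟩

/-- the continued (1.83) entry symbol is CONTINUOUS at `p′ = 0` (indeed holomorphic there: the origin is a point of the
zero-free strip `Strip d κ₁₈₃(d)` of `B5G183Strip`, `differentiableAt_g183`). [folklore] -/
theorem continuousAt_g183_zero (n : ℕ) [NeZero n] (μ ν : Fin d) (k k' : Fin d → Fin n) :
    ContinuousAt (fun q : Fin d → ℂ => g183 n μ ν k k' q) 0 :=
  (differentiableAt_g183 n (kappa183_pos d).le le_rfl (zero_mem_Strip (kappa183_pos d).le) μ ν k k').continuousAt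

/-- `g183 μ ν l l′ (p′) → G₀((l,μ),(l′,ν))` as complex `p′ → 0`. [folklore] -/
theorem tendsto_g183_zero (n : ℕ) [NeZero n] (μ ν : Fin d) (k k' : Fin d → Fin n) :
    Tendsto (fun q : Fin d → ℂ => g183 n μ ν k k' q) (𝓝 0)
      (𝓝 (G₀ (fun _ => (0 : Fin n)) 1 (fun l => DeltaXir n 0 (shiftr n l (0 : Fin d → ℝ))) (k, μ) (k', ν))) := by
  rw [← g183_at0_eq_G₀]
  exact continuousAt_g183_zero n μ ν k k'

/-- `g183 μ ν l l′ (s) → G₀((l,μ),(l′,ν))` as REAL `s → 0`. [folklore] -/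
theorem tendsto_g183_ofRealVec_zero (n : ℕ) [NeZero n] (μ ν : Fin d) (k k' : Fin d → Fin n) :
    Tendsto (fun s : Fin d → ℝ => g183 n μ ν k k' (ofRealVec s)) (𝓝 0)
      (𝓝 (G₀ (fun _ => (0 : Fin n)) 1 (fun l => DeltaXir n 0 (shiftr n l (0 : Fin d → ℝ))) (k, μ) (k', ν))) := by
  have h := (continuous_ofRealVec (d := d)).tendsto (0 : Fin d → ℝ)
  rw [ofRealVec_zero_eq] at h
  exact (tendsto_g183_zero n μ ν k k').comp h

/-- **THE PRINTED SENTENCE, p. 33 [PDF 17] ll. 1–2, at `a = 1`**: «It can be easily calculated that the values at p′ = 0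
agree with the second and third equalities in (1.83).»  For every `n ≥ 1`, all `μ, ν` and all alias indices `l, l′`:
the `((l,μ),(l′,ν))` entry of the TYPED fiber matrix (1.83) of `G = Δ_1⁻¹` (`B5Prop11Bound.Fiber.G` on
`B5Prop11Fiber.balabanFiber`, defined for real `p′ = s ≠ 0` in `[−π,π]^d`) converges, as `s → 0` through the punctured
Brillouin zone, to the corresponding entry of Bałaban's zero fiber `B5Prop11Bound.G₀` = `diag(1 at l = 0, Δ(l)⁻¹ else)`
— i.e. the value at `p′ = 0` of the continuity extension of the first equality of (1.83) AGREES with its second and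
third equalities.  [cite: Balaban1984PropagatorsI, text p.33 ll.1–2 with (1.83) p.31 (text only; the calculation is ours)] -/
theorem fiberG_tendsto_G₀ (n : ℕ) [NeZero n] (hn : 1 ≤ n) (μ ν : Fin d) (k k' : Fin d → Fin n) :
    ∀ ε > 0, ∃ δ > 0, ∀ (s : Fin d → ℝ) (hs : ∀ μ, |s μ| ≤ Real.pi) (hs0 : s ≠ 0), ‖s‖ < δ →
      ‖(balabanFiber n hn 1 one_pos s hs hs0).G (k, μ) (k', ν)
          - G₀ (fun _ => (0 : Fin n)) 1 (fun l => DeltaXir n 0 (shiftr n l (0 : Fin d → ℝ))) (k, μ) (k', ν)‖ < ε := by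
  intro ε hε
  obtain ⟨δ, hδ, h⟩ := Metric.tendsto_nhds_nhds.mp (tendsto_g183_ofRealVec_zero n μ ν k k') ε hε
  refine ⟨δ, hδ, fun s hs hs0 hsδ => ?_⟩
  have h' : dist (g183 n μ ν k k' (ofRealVec s))
      (G₀ (fun _ => (0 : Fin n)) 1 (fun l => DeltaXir n 0 (shiftr n l (0 : Fin d → ℝ))) (k, μ) (k', ν)) < ε :=
    h (by rw [dist_zero_right]; exact hsδ)
  rwa [dist_eq_norm, g183_ofReal n hn s hs hs0 μ ν k k'] at h'

/-- the same sentence read entrywise as VALUES: the `l = l′ = 0`, `μ = ν` entry tends to `1 = a⁻¹` (the third equality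
of (1.83) at `a = 1`; cf. (1.82) «GJ = GJ′ + a⁻¹J₀», `J₀` constant), the `l = l′ ≠ 0`, `μ = ν` entries tend to `1/Δ(l)` (the
second equality), and every off-diagonal entry tends to `0`. [folklore] -/
theorem fiberG_tendsto_values (n : ℕ) [NeZero n] (hn : 1 ≤ n) (μ ν : Fin d) (k k' : Fin d → Fin n) :
    ∀ ε > 0, ∃ δ > 0, ∀ (s : Fin d → ℝ) (hs : ∀ μ, |s μ| ≤ Real.pi) (hs0 : s ≠ 0), ‖s‖ < δ →
      ‖(balabanFiber n hn 1 one_pos s hs hs0).G (k, μ) (k', ν)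
          - (if k = k' ∧ μ = ν then
              (if k = fun _ => 0 then 1 else 1 / ((DeltaXir n 0 (shiftr n k (0 : Fin d → ℝ)) : ℝ) : ℂ))
             else 0)‖ < ε := by
  rw [← G₀_at0_apply]
  exact fiberG_tendsto_G₀ n hn μ ν k k'

end Literature.MathematicalPhysics.QuantumFieldTheory.Balaban1983to89.B5G183Zero
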